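import Literature.AlgebraicGeometry.HyperbolicPolynomials.Garding
import Literature.Combinatorics.StablePolynomials.Basic
import HarnessLib

/-!
# The hyperbolicity cone is a connected component of `{p ≠ 0}`; two-parameter real stability

Topic `Literature/AlgebraicGeometry/HyperbolicPolynomials`, a short companion of `Garding.lean`
(Gårding's theorem: `IsHyperbolic.of_mem_openHyperbolicityCone`, `openHyperbolicityCone_eq_of_mem`,
`convex_openHyperbolicityCone`). It proves the two remaining clauses of the "fundamental properties of
the hyperbolicity cone" as listed by Borcea–Brändén–Liggett (J. Amer. Math. Soc. 22 (2009), §4.1):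

> Let `p` be hyperbolic with respect to `e ∈ ℝⁿ`. The cone `C_e(p) = {x ∈ ℝⁿ : p(x + te) ≠ 0, t ≥ 0}`
> is called the hyperbolicity cone of `p`. […] **Proposition 4.4.** Let `p ∈ ℝ[z_1, …, z_n]` be
> hyperbolic with respect to `e ∈ ℝⁿ`. Then (a) `C_e(p)` is convex; (b) `C_e(p)` is equal to the
> connected component of the set `{x ∈ ℝⁿ : p(x) ≠ 0}` that contains `e`; (c) `(s,t) ↦ p(x + su + te)` is
> real stable for any `x ∈ ℝⁿ` and `u ∈ C_e(p)`; (d) `p` is hyperbolic with respect to any `u ∈ C_e(p)`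
> and `C_u(p) = C_e(p)`.

Here `C_e(p)` is *literally* the tree's `openHyperbolicityCone p e` (`= {x | ∀ τ ≥ 0, p(x + τe) ≠ 0}`);
(a) and (d) are `convex_openHyperbolicityCone`, `IsHyperbolic.of_mem_openHyperbolicityCone` and
`openHyperbolicityCone_eq_of_mem` of `Garding.lean`. Clause (b) is Renegar's Proposition 1
("The hyperbolicity cone is the connected component of `{x : p(x) ≠ 0}` containing `e`"). As everywhere
in this directory hyperbolic *forms* are meant (`p.IsHomogeneous d` is an explicit hypothesis).

## Main results (namespace `Literature.AlgebraicGeometry.HyperbolicPolynomials`)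

* `openHyperbolicityCone_eq_connectedComponentIn` — **Prop. 4.4 (b)** / Renegar Prop. 1:
  `Λ₊₊(p, e) = connectedComponentIn {x | p x ≠ 0} e`; with the corollaries
  `isConnected_openHyperbolicityCone`, `connectedComponentIn_eq_openHyperbolicityCone_of_mem`
  (the component of any `b ∈ Λ₊₊(p,e)` is the same cone), `mem_openHyperbolicityCone_of_segment_subset` /
  `mem_openHyperbolicityCone_of_isPreconnected` (a point joined to a point of the cone by a segment, or by
  any preconnected set, avoiding `{p = 0}` lies in the cone).
* `eval_ne_zero_of_im_mem_openHyperbolicityCone` — `p(x + iy) ≠ 0` for real `x` and `y ∈ Λ₊₊(p, e)`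
  (hyperbolicity in direction `y`, Prop. 4.4 (d)); `isRealStable_twoParam` — **Prop. 4.4 (c)**: the
  bivariate polynomial `(s,t) ↦ p(x + su + te)` (`u ∈ Λ₊₊(p,e)`), realised as
  `bind₁ (fun i => C (x i) + C (u i) * X (0 : Fin 2) + C (e i) * X (1 : Fin 2)) p : MvPolynomial (Fin 2) ℝ`, is real stable;
  `isRealStable_lineParam` — so is `t ↦ p(x + tu)` (one parameter).

Proof of (b): `Λ₊₊` is convex, hence preconnected, contains `e` and misses `{p = 0}`, so it lies in the
component; conversely the component `S` is covered by the disjoint open sets `Λ₊₊` and `(Λ₊)ᶜ` (a point of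
`S` in the closed cone `Λ₊` has `p ≠ 0`, hence is in `Λ₊₊`: `mem_openHyperbolicityCone_of_eval_ne_zero`),
and meets the first at `e`. Proof of (c): for `Im s, Im t > 0` the imaginary part of the argument is
`(Im s) u + (Im t) e ∈ Λ₊₊`, a direction of hyperbolicity, so `p ≠ 0` there. No named facts are introduced.

## References

* [BorceaBrandenLiggett2007] J. Borcea, P. Brändén, T. M. Liggett, *Negative dependence and the geometry
  of polynomials*, J. Amer. Math. Soc. 22 (2009) 521–567 (arXiv:0707.2340): §4.1, Prop. 4.4 (b), (c)
  (PDF p. 15).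
* [Renegar2006] J. Renegar, *Hyperbolic programs, and their derivative relaxations*, Found. Comput. Math. 6
  (2006) 59–79: §2, Prop. 1 (p. 3 of the journal version).
* [Garding1959] L. Gårding, *An inequality for hyperbolic polynomials*, J. Math. Mech. 8 (1959) 957–965,
  §2 (the source of Prop. 4.4).
-/

noncomputable section

open MvPolynomial
open _root_.Topology

namespace Literature.AlgebraicGeometry.HyperbolicPolynomials

variable {σ : Type*} {f : MvPolynomial σ ℝ} {d : ℕ} {e : σ → ℝ}

/-! ## §1 Prop. 4.4 (b): the open cone is the connected component of `{p ≠ 0}` containing `e` -/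

section Component

/-- **Prop. 4.4 (b) / Renegar's Proposition 1**: for a form `p` hyperbolic with respect to `e`, the open
hyperbolicity cone `C_e(p) = Λ₊₊(p, e)` is the connected component of `{x : p(x) ≠ 0}` containing `e`.
[cite: BorceaBrandenLiggett2007, §4.1 Prop. 4.4 (b)] [cite: Renegar2006, §2 Prop. 1] -/
theorem openHyperbolicityCone_eq_connectedComponentIn (hf : f.IsHomogeneous d) (he : IsHyperbolic f e) :
    openHyperbolicityCone f e = connectedComponentIn {x | MvPolynomial.eval x f ≠ 0} e := by
  refine Set.Subset.antisymm ?_ ?_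
  · -- `Λ₊₊` is convex, contains `e`, and misses `{p = 0}`
    exact (convex_openHyperbolicityCone hf he).isPreconnected.subset_connectedComponentIn
      (self_mem_openHyperbolicityCone hf he.eval_ne_zero) fun x hx => eval_ne_zero_of_mem_openHyperbolicityCone hx
  · -- the component is covered by the disjoint open sets `Λ₊₊` and `(Λ₊)ᶜ` and meets `Λ₊₊` at `e`
    refine isPreconnected_connectedComponentIn.subset_left_of_subset_union
      (he.isOpen_openHyperbolicityCone hf) (isClosed_hyperbolicityCone hf he).isOpen_compl ?_ ?_
      ⟨e, mem_connectedComponentIn (show MvPolynomial.eval e f ≠ 0 from he.eval_ne_zero),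
        self_mem_openHyperbolicityCone hf he.eval_ne_zero⟩
    · exact Set.disjoint_compl_right_iff_subset.2 (openHyperbolicityCone_subset f e)
    · intro x hx
      by_cases hx' : x ∈ hyperbolicityCone f e
      · exact Or.inl (mem_openHyperbolicityCone_of_eval_ne_zero hx' (connectedComponentIn_subset _ _ hx))
      · exact Or.inr hx'

/-- The open hyperbolicity cone of a hyperbolic form is connected. [cite: Renegar2006, §2 Prop. 1] -/
theorem isConnected_openHyperbolicityCone (hf : f.IsHomogeneous d) (he : IsHyperbolic f e) :
    IsConnected (openHyperbolicityCone f e) :=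
  (convex_openHyperbolicityCone hf he).isConnected ⟨e, self_mem_openHyperbolicityCone hf he.eval_ne_zero⟩

/-- The connected component of `{p ≠ 0}` containing any point `b` of `C_e(p)` is `C_e(p)` itself
(Prop. 4.4 (b) together with (d), `C_b(p) = C_e(p)`). [cite: BorceaBrandenLiggett2007, §4.1 Prop. 4.4
(b), (d)] -/
theorem connectedComponentIn_eq_openHyperbolicityCone_of_mem (hf : f.IsHomogeneous d)
    (he : IsHyperbolic f e) {b : σ → ℝ} (hb : b ∈ openHyperbolicityCone f e) :
    connectedComponentIn {x | MvPolynomial.eval x f ≠ 0} b = openHyperbolicityCone f e := by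
  rw [openHyperbolicityCone_eq_connectedComponentIn hf he]
  rw [openHyperbolicityCone_eq_connectedComponentIn hf he] at hb
  exact (connectedComponentIn_eq hb).symm

/-- A preconnected subset of `{p ≠ 0}` meeting `C_e(p)` lies inside `C_e(p)` (e.g. a path on which `p`
does not vanish, starting in the cone). [cite: Renegar2006, §2 Prop. 1 (proof)] -/
theorem subset_openHyperbolicityCone_of_isPreconnected (hf : f.IsHomogeneous d) (he : IsHyperbolic f e)
    {s : Set (σ → ℝ)} (hs : IsPreconnected s) (hs0 : ∀ x ∈ s, MvPolynomial.eval x f ≠ 0) {b : σ → ℝ}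
    (hbs : b ∈ s) (hb : b ∈ openHyperbolicityCone f e) : s ⊆ openHyperbolicityCone f e := by
  rw [← connectedComponentIn_eq_openHyperbolicityCone_of_mem hf he hb]
  exact hs.subset_connectedComponentIn hbs hs0

/-- A point joined to a point of `C_e(p)` by a preconnected subset of `{p ≠ 0}` lies in `C_e(p)`.
[cite: Renegar2006, §2 Prop. 1 (proof)] -/
theorem mem_openHyperbolicityCone_of_isPreconnected (hf : f.IsHomogeneous d) (he : IsHyperbolic f e)
    {s : Set (σ → ℝ)} (hs : IsPreconnected s) (hs0 : ∀ x ∈ s, MvPolynomial.eval x f ≠ 0) {b x : σ → ℝ}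
    (hbs : b ∈ s) (hb : b ∈ openHyperbolicityCone f e) (hxs : x ∈ s) : x ∈ openHyperbolicityCone f e :=
  subset_openHyperbolicityCone_of_isPreconnected hf he hs hs0 hbs hb hxs

/-- **Segment form of Prop. 4.4 (b)**: if `p` does not vanish on the segment `[b, x]` and `b ∈ C_e(p)`, then
`x ∈ C_e(p)` (this is how Borcea–Brändén–Liggett use (b) in the proof of Thm. 4.5: "`C_e(f_H)` contains the
cone `ℝ^{n+1}_+`"). [cite: BorceaBrandenLiggett2007, §4.1 Prop. 4.4 (b) and proof of Thm. 4.5] -/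
theorem mem_openHyperbolicityCone_of_segment_subset (hf : f.IsHomogeneous d) (he : IsHyperbolic f e)
    {b x : σ → ℝ} (hb : b ∈ openHyperbolicityCone f e)
    (hseg : segment ℝ b x ⊆ {y | MvPolynomial.eval y f ≠ 0}) : x ∈ openHyperbolicityCone f e :=
  mem_openHyperbolicityCone_of_isPreconnected hf he (convex_segment b x).isPreconnected
    (fun _ hy => hseg hy) (left_mem_segment ℝ b x) hb (right_mem_segment ℝ b x)

/-- Conversely, `p` does not vanish on a segment with both ends in `C_e(p)` ((a): the cone is convex).
[cite: BorceaBrandenLiggett2007, §4.1 Prop. 4.4 (a)] -/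
theorem eval_ne_zero_of_mem_segment (hf : f.IsHomogeneous d) (he : IsHyperbolic f e) {b x y : σ → ℝ}
    (hb : b ∈ openHyperbolicityCone f e) (hx : x ∈ openHyperbolicityCone f e) (hy : y ∈ segment ℝ b x) :
    MvPolynomial.eval y f ≠ 0 :=
  eval_ne_zero_of_mem_openHyperbolicityCone ((convex_openHyperbolicityCone hf he).segment_subset hb hx hy)

end Component

/-! ## §2 Prop. 4.4 (c): `(s, t) ↦ p(x + su + te)` is real stable for `u ∈ C_e(p)` -/

section TwoParam

open Literature.Combinatorics.StablePolynomials

/-- **`p(x + iy) ≠ 0` for real `x` and `y ∈ C_e(p)`**: `p` is hyperbolic in direction `y` (Prop. 4.4 (d)),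
so the zeros of `t ↦ p(x + ty)` are real and `t = i` is not one of them.
[cite: BorceaBrandenLiggett2007, §4.1 Prop. 4.4 (d)] -/
theorem eval_ne_zero_of_im_mem_openHyperbolicityCone (hf : f.IsHomogeneous d) (he : IsHyperbolic f e)
    (x : σ → ℝ) {y : σ → ℝ} (hy : y ∈ openHyperbolicityCone f e) :
    MvPolynomial.eval (fun j => (x j : ℂ) + Complex.I * (y j : ℂ)) (MvPolynomial.map (algebraMap ℝ ℂ) f)
      ≠ 0 := fun h0 => by
  have := (he.of_mem_openHyperbolicityCone hf hy).2 x Complex.I h0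
  simp at this

/-- Evaluation of the substituted polynomial `p(x + s u + t e)` at a complex point `(s, t) = (z 0, z 1)`:
it is `p` at the complex vector `x + z₀ u + z₁ e`. [folklore] -/
private theorem eval_map_bind₁_twoParam (f : MvPolynomial σ ℝ) (x u e : σ → ℝ) (z : Fin 2 → ℂ) :
    MvPolynomial.eval z (MvPolynomial.map (algebraMap ℝ ℂ)
      (bind₁ (fun i => C (x i) + C (u i) * X (0 : Fin 2) + C (e i) * X (1 : Fin 2)) f)) =
    MvPolynomial.eval (fun j => (x j : ℂ) + z 0 * (u j : ℂ) + z 1 * (e j : ℂ))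
      (MvPolynomial.map (algebraMap ℝ ℂ) f) := by
  rw [map_bind₁, Literature.Combinatorics.StablePolynomials.eval_bind₁]
  refine congrArg (fun g : σ → ℂ => MvPolynomial.eval g (MvPolynomial.map (algebraMap ℝ ℂ) f)) ?_
  funext j
  simp only [map_add, map_mul, map_C, map_X, eval_C, eval_X, Complex.coe_algebraMap]
  ring

/-- **Prop. 4.4 (c)**: for a form `p` hyperbolic with respect to `e`, any `x ∈ ℝⁿ` and any `u ∈ C_e(p)`, the
bivariate polynomial `(s, t) ↦ p(x + su + te)` — here `bind₁ (fun i => C (x i) + C (u i) * X (0 : Fin 2) + C (e i) * X (1 : Fin 2)) p`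
in the variables `s = X 0`, `t = X 1` — is real stable: for `Im s, Im t > 0` the imaginary part of
`x + su + te` is `(Im s) u + (Im t) e ∈ C_e(p)`, a direction of hyperbolicity.
[cite: BorceaBrandenLiggett2007, §4.1 Prop. 4.4 (c)] -/
theorem isRealStable_twoParam (hf : f.IsHomogeneous d) (he : IsHyperbolic f e) (x : σ → ℝ) {u : σ → ℝ}
    (hu : u ∈ openHyperbolicityCone f e) :
    IsRealStable (bind₁ (fun i => C (x i) + C (u i) * X (0 : Fin 2) + C (e i) * X (1 : Fin 2)) f) := by
  intro z hz h0
  rw [eval_map_bind₁_twoParam] at h0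
  -- split the complex point into real and imaginary parts
  have hpt : (fun j => (x j : ℂ) + z 0 * (u j : ℂ) + z 1 * (e j : ℂ)) =
      fun j => ((x j + (z 0).re * u j + (z 1).re * e j : ℝ) : ℂ) +
        Complex.I * (((z 0).im * u j + (z 1).im * e j : ℝ) : ℂ) := by
    funext j
    apply Complex.ext <;> simp
  rw [hpt] at h0
  refine eval_ne_zero_of_im_mem_openHyperbolicityCone hf he _ (y := fun j => (z 0).im * u j + (z 1).im * e j)
    ?_ h0
  have hmem : (z 0).im • u + (z 1).im • e ∈ openHyperbolicityCone f e :=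
    add_mem_openHyperbolicityCone hf he (smul_mem_openHyperbolicityCone hf hu (hz 0))
      (smul_mem_openHyperbolicityCone hf (self_mem_openHyperbolicityCone hf he.eval_ne_zero) (hz 1))
  convert hmem using 1
  funext j
  simp [Pi.add_apply, Pi.smul_apply, smul_eq_mul]

/-- Evaluation of `p(x + t u)` at a complex `t = z 0`. [folklore] -/
private theorem eval_map_bind₁_lineParam (f : MvPolynomial σ ℝ) (x u : σ → ℝ) (z : Fin 1 → ℂ) :
    MvPolynomial.eval z (MvPolynomial.map (algebraMap ℝ ℂ) (bind₁ (fun i => C (x i) + C (u i) * X (0 : Fin 1)) f)) =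
    MvPolynomial.eval (fun j => (x j : ℂ) + z 0 * (u j : ℂ)) (MvPolynomial.map (algebraMap ℝ ℂ) f) := by
  rw [map_bind₁, Literature.Combinatorics.StablePolynomials.eval_bind₁]
  refine congrArg (fun g : σ → ℂ => MvPolynomial.eval g (MvPolynomial.map (algebraMap ℝ ℂ) f)) ?_
  funext j
  simp only [map_add, map_mul, map_C, map_X, eval_C, eval_X, Complex.coe_algebraMap]
  ring

/-- **One-parameter form of Prop. 4.4 (c)**: `t ↦ p(x + tu)` (`u ∈ C_e(p)`) is a real stable (= real-rooted,
nonzero) univariate polynomial, written as `bind₁ (fun i => C (x i) + C (u i) * X (0 : Fin 1)) p : MvPolynomial (Fin 1) ℝ`.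
[cite: BorceaBrandenLiggett2007, §4.1 Prop. 4.4 (c), (d)] -/
theorem isRealStable_lineParam (hf : f.IsHomogeneous d) (he : IsHyperbolic f e) (x : σ → ℝ) {u : σ → ℝ}
    (hu : u ∈ openHyperbolicityCone f e) :
    IsRealStable (bind₁ (fun i => C (x i) + C (u i) * X (0 : Fin 1)) f) := by
  intro z hz h0
  rw [eval_map_bind₁_lineParam] at h0
  have := (he.of_mem_openHyperbolicityCone hf hu).2 x (z 0) h0
  exact (hz 0).ne' this

end TwoParam

end Literature.AlgebraicGeometry.HyperbolicPolynomials
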